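import Literature.AlgebraicGeometry.Milne1999.SpecialLefschetzGroupInvariantsSp2Multiplicity
import Literature.RepresentationTheory.ClassicalInvariants.TensorFFTGeneralLinear
import HarnessLib

/-!
# Milne 1999, Prop. 3.6 (c) with multiplicity: the `S`-invariants of `⋀•(⊕_s W_{σ(s)}^{(±)})` under
# colourwise `GL(W_σ)`'s acting with multiplicity (standard ⊕ contragredient) are Lefschetz classes

Family `hodge`, layer `Literature/AlgebraicGeometry/Milne1999`, namespace
`Literature.AlgebraicGeometry.Milne1999` (D-0022). One definition (`glPairWord`, a word combinator), no
named fact, no `sorry` (D-0026, net debt 0). Written for the cell `pub-hodgecm2` (COR-CM), seat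
`lit-milne`, binder table `HOME/lit/milne.md` rows M2/M4 (the record
`Milne1999_specialLefschetzGroup_invariants_le` of `Milne1999/LefschetzGroup`: Cor. 4.5 with Thm. 4.4 and
Thm. 3.2). Sequel of `Milne1999/SpecialLefschetzGroupInvariantsSp2Multiplicity` (Prop. 3.6 (a) with
multiplicity for `Sp₂`-blocks), whose "NOT here" reads: "blocks `Sp_{2n}`, `n ≥ 2`, `O`, `GL` with
multiplicity (Prop. 3.6 in full) — the tree has the FFT for `SL₂` only." This file supplies the `GL` case
— Prop. 3.6 (c) WITH ARBITRARY RANK AND MULTIPLICITY — on the tree's carriers, using the tensor first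
fundamental theorem for `GL(V)` now in the tree (`ClassicalInvariants/TensorFFTGeneralLinear`,
Goodman–Wallach Thm. 5.3.1, coloured and interleaved; from Schur's commutant theorem
`ClassicalInvariants/SchurWeylCommutant`, Goodman–Wallach Thm. 4.2.10).

## Source, verbatim

J. S. Milne, *Lefschetz classes on abelian varieties*, Duke Math. J. 96 (1999) 639–675
[`paper:doi-10-1215-s0012-7094-99-09620-5`, held; PDF page = printed page − 638; read 2026-08-21,
pp. 650–651 = p0012–p0013, pp. 655–656 = p0017–p0018]:

* p. 651 (p0013 L78–L81), simple abelian variety of type IV: "`S_σ ≈ Aut_{M_d(k^al)}(V₁) ≈ GL_{fg/d}(k^al)`.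
  The representation of `S_σ` on `V_σ` is isomorphic to the direct sum of `d` copies of the standard
  representation of `GL_{fg/d}(k^al)` and `d` copies of its contragredient." (p. 650, p0012 L61: type II/III
  analogues "its representation on `V_σ2` is the contragredient of the standard representation".)
* p. 655 (p0017 L8–L12): "The general linear group. Let `G = GL(V)`. Then `(V^{⊗m} ⊗ H^{⊗n})^G = 0` for
  `m ≠ n`, and `(V^{⊗m} ⊗ H^{⊗m})^G` is generated as a `k`-vector space by the tensors `t(σ)`, `σ ∈ S_m`,
  where `t(σ)` is the element `f_1 ⊗ ⋯ ⊗ f_m ⊗ x_1 ⊗ ⋯ ⊗ x_m ↦ f_1(x_{σ(1)}) ⋯ f_m(x_{σ(m)})` of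
  `(H^{⊗m} ⊗ V^{⊗m})^∨ = V^{⊗m} ⊗ H^{⊗m}` (ibid. F.20)."
* **Prop. 3.6** (p. 655, p0017 L13–L20): "With the above notations, `(⋀^*(rH))^G = k[(⊗² rH)^G]` all
  `r ≥ 1`, in each of the following cases: (a) […]; (b) […]; (c) `G = GL(W)` and `V = W ⊕ W^∨` (`G` acts
  on `W^∨` via the contragredient representation)." Proof of (c) (p0017 L38–L48): "we need only consider
  a `G`-invariant tensor in a space `X_1 ⊗ X_2 ⊗ ⋯ ⊗ X_m` in which each `X_i` is either `W` or `W^∨`. But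
  this space contains no nonzero `G`-invariant tensor unless `m` is even and there are `m/2` copies each
  of `W` and `W^∨`. After applying a permutation, we may assume our space is `W^{∨⊗m/2} ⊗ W^{⊗m/2}`. The
  `G`-invariant tensors in this space are linear combinations of forms
  `(f_1, …, f_{m/2}, x_1, …, x_{m/2}) ↦ ∏ f_i(x_{σ(i)})`, `σ ∈ S_{m/2}`, each of which is visibly a
  product of 2-forms."
* Remark 3.7 (p. 656) and p. 656 L14–L40 ("Completion of the proof of Proposition 3.4 […] each of the
  `k`-algebras `(⋀^* rH_σ)^{S_σ}` is generated by tensors of degree 2"); Prop. 3.3 (p. 653); Cor. 4.5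
  (p. 659): "`H^{2*}(A^r)(*)^{L(A)} = D_hom(A^r)_k`."

## What is proved (the tree's carriers `H•(B(ℂ); ℂ) = ⋀• H¹`)

The abstract situation of p. 656 with EVERY `S_σ ≅ GL(W_σ)` — blocks of ANY rank `n` and ANY
multiplicities of `W_σ` and of `W_σ^∨`. DATA: a complex abelian variety `B`; a basis `b` of `H¹(B(ℂ); ℂ)`
indexed by `J × Fin n` (slot `s`, letter `ℓ`); a colouring `col : J → ι` (slots of one colour = the copies
of `W_σ` and of `W_σ^∨` for one `σ`) and a typing `vec : J → Bool` (copy of `W_σ` / copy of `W_σ^∨`); a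
subgroup `G ≤ GL(H¹)` (intended: `S(B)(ℂ) = unitaryCentralizerGroup`) containing for every
`g ∈ ∏_{i ∈ ι} GL_n(ℂ)` the element acting on the slot `s` by the matrix `g_{col s}` (vector slots)
resp. `(g_{col s}⁻¹)ᵀ` (covector slots); and the hypothesis that the CROSSED CLASSES
`θ_{s,s'} = ∑_ℓ b(s,ℓ) ⌣ b(s',ℓ)` of a vector slot `s` and a covector slot `s'` of the same colour lie in
`B¹(B) ⊗ ℂ` (Prop. 3.3: the degree-`2` invariants — the pairings — are divisor classes).

* **`mem_divisorClassesSpan_of_forall_exteriorPullback_eq_of_glColouring`** — CONCLUSION: every class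
  `x ∈ H^{2p}(B(ℂ); ℂ)` fixed by `⋀^{2p}u` for all `u ∈ G` lies in `Dᵖ(B) ⊗ ℂ = divisorClassesSpan B.X B.dim p`
  (Prop. 3.6 (c) with multiplicity, in the `S(ℂ)`-form consumed by the tree's polarization packages of
  `SpecialLefschetzGroupInvariantsFiniteProducts`).
* The road: (1) `x = ∑_w a(w) · b_w` with `a` antisymmetric (`exists_isAntisymm_wordEval_eq`); (2) `⋀u`
  acts on coefficient functions by the slot-dependent letter change, so every slice `a(t, −)` is fixed
  by the mixed Kronecker product `⊗_q g^{(±)}_{col (t q)}` (`wordRepAt_wordSlice_eq_of_exteriorPullback_eq'`,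
  letters `Fin n`; `= ClassicalInvariants.mixedFamily ℂ (col ∘ t) (vec ∘ t) g`); (3) the TENSOR FFT FOR `GL`
  (`ClassicalInvariants.mem_span_contractionTensor_of_forall_wordRepAt_mixedFamily_eq`): each slice is a
  combination of the complete contractions `C_β` of colour-preserving bijections `β` from the vector to
  the covector positions — Milne's "no nonzero invariant unless `m/2` copies each" and "linear
  combinations of `∏ f_i(x_{σ(i)})`" WITHOUT "after applying a permutation" (interleaved positions);
  (4) the evaluation of `C_β` on the letters is `sgn(π_β) ∑_λ m_{2p}(glPairWord)` (`sum_contractionTensor_smul_eq`: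
  reorder the positions into the pairs `(a, β a)`, the pair carrying a common letter `λ`), and
  `∑_λ m_{2p}(glPairWord) = θ_{·,·} ⌣ ⋯ ⌣ θ_{·,·} ∈ Dᵖ ⊗ ℂ` (`sum_cupPowOne_glPairWord_mem`: "each of which
  is visibly a product of 2-forms", Remark 3.7).

NOT here: the application to powers `A^{N+1}` of an abelian variety whose `S(A)(ℂ)` is a product of
general linear groups (type IV with `d = 1`: `C(A) ⊗ ℂ` the commutant of one `φ^*` with NO self-dual
eigenvalue; sequel); blocks `Sp_{2n}` (`n ≥ 2`) and `O_n` with multiplicity (Prop. 3.6 (a) rank ≥ 4, (b):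
no FFT for `Sp_{2n}`/`O_n` in the tree).

## References

* [Milne1999LefschetzClasses] J. S. Milne, Lefschetz classes on abelian varieties, Duke Math. J. 96 (1999)
  639–675: §2 pp. 650–651 (types II–IV: standard ⊕ contragredient), p. 655 "The general linear group",
  Prop. 3.6 (c) and its proof, Remark 3.7, p. 656, Prop. 3.3 (p. 653), Cor. 4.5 (p. 659).
* [GoodmanWallachGTM255] R. Goodman, N. R. Wallach, Symmetry, Representations, and Invariants, GTM 255
  (2009), Thm. 4.2.10, Thm. 5.3.1, §4.1.1.
* [FultonHarris1991] W. Fulton, J. Harris, Representation Theory, GTM 129 (1991), App. F.20 (Milne's cite).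
* [Greub1978Multilinear] W. Greub, Multilinear Algebra, 2nd ed. (1978), §4.2, §5.7.
* [FultonYoungTableaux1997] W. Fulton, Young Tableaux (1997), §8.1.
-/

noncomputable section

open scoped BigOperators Matrix
open Literature.AlgebraicTopology.SingularHomology
open Literature.AlgebraicGeometry.HodgeTheory
open Literature.AlgebraicGeometry.Motives
open Literature.Barriers.HodgeConjecture (divisorClassesSpan)
open Literature.RepresentationTheory.GeneralLinear
open Literature.RepresentationTheory.ClassicalInvariants
open Literature.NumberTheory.DiophantineGeometry

namespace Literature.AlgebraicGeometry.Milne1999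

/-! ### §1 Invariance of a class under `⋀^d u` ⟹ invariance of the slices of its coefficient function (letters `J × Fin n`) -/

section Coefficients

variable {B : AbelianVariety ℂ} {J : Type*} [Fintype J] [DecidableEq J] {n d : ℕ}

/-- **Invariance of a class under `⋀^d u` ⟹ invariance of the slices of its antisymmetric coefficient
function under the Kronecker products of the matrices of `u`**, for a basis indexed by slots `s ∈ J` and
letters `ℓ ∈ Fin n` (the case `n = 2` is the tree's `wordRepAt_wordSlice_eq_of_exteriorPullback_eq`; same
proof): if `u(b(s,ℓ)) = ∑_{ℓ'} (G_s)_{ℓ' ℓ} b(s,ℓ')` and `⋀^d u` fixes `x = ∑_w a(w) b_w` (`a`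
antisymmetric), then every slice `a(t, −)` is fixed by `⊗_q G_{t(q)}`.
[cite: Greub1978Multilinear, §5.7 (5.12)–(5.13)] [cite: FultonYoungTableaux1997, §8.1] -/
theorem wordRepAt_wordSlice_eq_of_exteriorPullback_eq' (b : Module.Basis (J × Fin n) ℂ (complexBetti B.X 1))
    {a : (Fin d → J × Fin n) → ℂ} (ha : IsAntisymm a)
    (u : complexBetti B.X 1 →ₗ[ℂ] complexBetti B.X 1) (G : J → Matrix (Fin n) (Fin n) ℂ)
    (hu : ∀ s ℓ, u (b (s, ℓ)) = ∑ ℓ', G s ℓ' ℓ • b (s, ℓ'))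
    (hx : exteriorPullback (AbelianVariety.hasExteriorCohomologyH1_complexPoints B) u d
        (wordEval (cupPowOneAlt ℂ (ComplexPoints B.X) d) b a) =
      wordEval (cupPowOneAlt ℂ (ComplexPoints B.X) d) b a)
    (t : Fin d → J) : wordRepAt ℂ (fun q => G (t q)) (wordSlice a t) = wordSlice a t := by
  set F := cupPowOneAlt ℂ (ComplexPoints B.X) d with hF
  have hFinj := injective_alternatingMapLinearEquiv_cupPowOneAlt B d
  have h1 : wordEval F b (colourChangeAt G a) = wordEval F b a := by
    rw [← wordEval_eq_wordEval_colourChangeAt F G (y := fun i => u (b i)) (y' := ⇑b) (fun s ℓ => hu s ℓ) a,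
      ← exteriorPullback_wordEval, hx]
  have h2 : colourChangeAt G a = a := (ha.colourChangeAt G).eq_of_wordEval_eq hFinj b ha h1
  rw [← wordSlice_colourChangeAt, h2]

end Coefficients

/-! ### §2 Evaluating a complete contraction on letters: `±` the sum over letters of the contracted pair words -/

section PairWords

variable {M : Type*} {ι' : Type*} {n : ℕ}

/-- The two elements of `Fin 2`. [folklore] -/
private theorem fin2_cases (r : Fin 2) : r = 0 ∨ r = 1 := by
  fin_cases r <;> simp

/-- **Contracted pair words**: the word of length `2m` whose positions `2c, 2c + 1` carry the letters
`y (I c, λ c), y (J c, λ c)` — the SAME letter index in the two slots of each pair (the evaluation pattern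
of a complete contraction `∑_ℓ e_ℓ ⊗ e_ℓ^*`, Goodman–Wallach (5.24)). [cite: GoodmanWallachGTM255, Thm. 5.3.1] -/
def glPairWord {m : ℕ} (y : ι' × Fin n → M) (I J : Fin m → ι') (lam : Fin m → Fin n) : Fin (2 * m) → M :=
  fun q => y (if ((posEquiv m).symm q).2 = 0 then I ((posEquiv m).symm q).1 else J ((posEquiv m).symm q).1,
    lam ((posEquiv m).symm q).1)

/-- Peeling the first pair off a contracted pair word. [cite: GoodmanWallachGTM255, Thm. 5.3.1] -/
theorem glPairWord_succ_apply {m : ℕ} (y : ι' × Fin n → M) (I J : Fin (m + 1) → ι')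
    (lam : Fin (m + 1) → Fin n) :
    ∀ q : Fin (2 * m + 1 + 1), glPairWord y I J lam q =
      (Fin.cons (y (I 0, lam 0)) (Fin.cons (y (J 0, lam 0))
        (glPairWord y (Fin.tail I) (Fin.tail J) (Fin.tail lam))) : Fin (2 * m + 1 + 1) → M) q := by
  intro q
  induction q using Fin.cases with
  | zero =>
    rw [Fin.cons_zero]
    simp only [glPairWord]
    rw [posEquiv_symm_zero]
    simp
  | succ q =>
    rw [Fin.cons_succ]
    induction q using Fin.cases with
    | zero =>
      rw [Fin.cons_zero]
      simp only [glPairWord]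
      rw [posEquiv_symm_one]
      simp
    | succ q =>
      rw [Fin.cons_succ]
      simp only [glPairWord]
      rw [posEquiv_symm_succ_succ]
      rfl

end PairWords

section ContractionEval

variable {K : Type*} [Field K] {M V : Type*} [AddCommGroup M] [Module K M] [AddCommGroup V]
  [Module K V] {ι' : Type*} {n p : ℕ} {B : AbelianVariety ℂ}

/-- **The sum over the letters of the contracted pair words is a product of crossed classes, hence in
`Dᵐ ⊗ ℂ`**, as soon as every pair's crossed class `θ_c = ∑_ℓ y(I c, ℓ) ⌣ y(J c, ℓ)` lies in `D¹ ⊗ ℂ`: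
`∑_λ m_{2m}(glPairWord y I J λ) = θ_0 ⌣ ⋯ ⌣ θ_{m-1}` (expand multilinearly; Milne's "generated by tensors
of degree 2" + Remark 3.7, the degree-`2` invariants of `GL(W)` on `W ⊕ W^∨` being the pairing).
[cite: Milne1999LefschetzClasses, Prop. 3.6 (c) and Remark 3.7 (pp. 655–656)]
[cite: GoodmanWallachGTM255, Thm. 5.3.1] -/
theorem sum_cupPowOne_glPairWord_mem {ι'' : Type*} (y : ι'' × Fin n → complexBetti B.X 1) :
    ∀ (m : ℕ) (I J : Fin m → ι''),
      (∀ c, (∑ ℓ : Fin n, cupProduct (rfl : 1 + 1 = 2) (y (I c, ℓ)) (y (J c, ℓ))) ∈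
        Submodule.span ℂ {b : complexBetti B.X 2 | IsRationalClass b ∧ IsOfHodgeType B.dim B.X 2 1 1 b}) →
      (∑ lam : Fin m → Fin n, cupPowOne ℂ (Motives.ComplexPoints B.X) (2 * m) (glPairWord y I J lam)) ∈
        divisorClassesSpan B.X B.dim m
  | 0, I, J, _ => by
    rw [Fintype.sum_unique]
    change cupPowOne ℂ (Motives.ComplexPoints B.X) 0 _ ∈ _
    rw [cupPowOne_zero]
    exact Submodule.subset_span (Barriers.HodgeConjecture.mem_divisorMonomials_zero.2 rfl)
  | m + 1, I, J, hθ => by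
    have IH := sum_cupPowOne_glPairWord_mem y m (Fin.tail I) (Fin.tail J) fun c => hθ c.succ
    have h2 : (2 : ℕ) + 2 * m = 2 * (m + 1) := by ring
    have hterm : ∀ (ℓ : Fin n) (lam' : Fin m → Fin n),
        cupPowOne ℂ (Motives.ComplexPoints B.X) (2 * (m + 1)) (glPairWord y I J (Fin.cons ℓ lam')) =
          cupProduct h2 (cupProduct (rfl : 1 + 1 = 2) (y (I 0, ℓ)) (y (J 0, ℓ)))
            (cupPowOne ℂ (Motives.ComplexPoints B.X) (2 * m) (glPairWord y (Fin.tail I) (Fin.tail J) lam')) := by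
      intro ℓ lam'
      have hw : glPairWord y I J (Fin.cons ℓ lam') = (Fin.cons (y (I 0, ℓ)) (Fin.cons (y (J 0, ℓ))
          (glPairWord y (Fin.tail I) (Fin.tail J) lam')) : Fin (2 * m + 1 + 1) → _) := by
        funext q
        rw [glPairWord_succ_apply, Fin.cons_zero, Fin.tail_cons]
      rw [hw, cupPowOne_cons_cons]
    have hsum : (∑ x : Fin n × (Fin m → Fin n), cupPowOne ℂ (Motives.ComplexPoints B.X) (2 * (m + 1))
        (glPairWord y I J ((Fin.consEquiv fun _ : Fin (m + 1) => Fin n) x))) =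
        cupProduct h2 (∑ ℓ : Fin n, cupProduct (rfl : 1 + 1 = 2) (y (I 0, ℓ)) (y (J 0, ℓ)))
          (∑ lam' : Fin m → Fin n, cupPowOne ℂ (Motives.ComplexPoints B.X) (2 * m)
            (glPairWord y (Fin.tail I) (Fin.tail J) lam')) := by
      rw [Fintype.sum_prod_type, map_sum (cupProduct h2), LinearMap.sum_apply]
      refine Finset.sum_congr rfl fun ℓ _ => ?_
      rw [map_sum (cupProduct h2 _)]
      exact Finset.sum_congr rfl fun lam' _ => hterm ℓ lam'
    rw [← (Fin.consEquiv fun _ : Fin (m + 1) => Fin n).sum_comp, hsum]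
    exact cupProduct_mem_divisorClassesSpan_succ_left h2 (hθ 0) IH

/-- The number of vector positions of a typing of `Fin (2p)` admitting a bijection onto the covector
positions is `p`. [folklore] -/
private theorem card_eq_of_equiv (ty : Fin (2 * p) → Bool)
    (β : {q : Fin (2 * p) // ty q = true} ≃ {q : Fin (2 * p) // ty q = false}) :
    Fintype.card {q : Fin (2 * p) // ty q = true} = p := by
  classical
  have h1 : Fintype.card {q : Fin (2 * p) // ty q = true} = Fintype.card {q : Fin (2 * p) // ty q = false} :=
    Fintype.card_congr β
  have h3 : Fintype.card {q : Fin (2 * p) // ¬ ty q = true} = Fintype.card {q : Fin (2 * p) // ty q = false} :=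
    Fintype.card_congr (Equiv.subtypeEquivRight fun q => by rw [Bool.not_eq_true])
  have h2 := Fintype.card_subtype_compl (fun q : Fin (2 * p) => ty q = true)
  have h4 := Fintype.card_subtype_le (fun q : Fin (2 * p) => ty q = true)
  rw [Fintype.card_fin] at h2 h4
  omega

/-- **Evaluating a complete contraction on position-dependent letters**: for an alternating `F` on
`2p` arguments and a bijection `β` from the vector to the covector positions,
`∑_ε C_β(ε) F(q ↦ y(t q, ε q)) = sgn(π) ∑_λ F(glPairWord y I J λ)`, where `π` reorders the positions into
the consecutive pairs `(a_c, β a_c)` (for an enumeration `c ↦ a_c` of the vector positions),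
`I c = t(a_c)`, `J c = t(β a_c)`, and the pair `c` carries the common letter `λ c`.
[cite: GoodmanWallachGTM255, Thm. 5.3.1] [cite: Greub1978Multilinear, §5.7] -/
theorem sum_contractionTensor_smul_eq (F : M [⋀^Fin (2 * p)]→ₗ[K] V) (ty : Fin (2 * p) → Bool)
    (β : {q : Fin (2 * p) // ty q = true} ≃ {q : Fin (2 * p) // ty q = false})
    (y : ι' × Fin n → M) (t : Fin (2 * p) → ι') :
    ∃ (π : Equiv.Perm (Fin (2 * p))) (eP : {q : Fin (2 * p) // ty q = true} ≃ Fin p),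
      ∑ ε : Word n (2 * p), contractionTensor K ty β ε • F (fun q => y (t q, ε q)) =
        ((Equiv.Perm.sign π : ℤ) : K) •
          ∑ lam : Fin p → Fin n,
            F (glPairWord y (fun c => t (eP.symm c : Fin (2 * p))) (fun c => t (β (eP.symm c) : Fin (2 * p))) lam) := by
  classical
  -- enumerate the vector positions
  let eP : {q : Fin (2 * p) // ty q = true} ≃ Fin p := Fintype.equivFinOfCardEq (card_eq_of_equiv ty β)
  -- the reordering of the positions into consecutive pairs `(a_c, β a_c)`
  let f : Fin p × Fin 2 → Fin (2 * p) := fun cr =>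
    if cr.2 = 0 then (eP.symm cr.1 : Fin (2 * p)) else (β (eP.symm cr.1) : Fin (2 * p))
  have hf_inj : Function.Injective f := by
    rintro ⟨c, r⟩ ⟨c', r'⟩ h
    rcases fin2_cases r with rfl | rfl <;> rcases fin2_cases r' with rfl | rfl
    · simp only [f, if_true] at h
      rw [Prod.mk.injEq]
      exact ⟨eP.symm.injective (Subtype.val_injective h), rfl⟩
    · simp only [f, if_true, Fin.one_eq_zero_iff, OfNat.ofNat_ne_one, if_false] at h
      have h1 := (eP.symm c).2
      have h2 := (β (eP.symm c')).2
      rw [h] at h1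
      rw [h1] at h2
      exact absurd h2 (by decide)
    · simp only [f, if_true, Fin.one_eq_zero_iff, OfNat.ofNat_ne_one, if_false] at h
      have h1 := (β (eP.symm c)).2
      have h2 := (eP.symm c').2
      rw [h] at h1
      rw [h1] at h2
      exact absurd h2 Bool.false_ne_true
    · simp only [f, Fin.one_eq_zero_iff, OfNat.ofNat_ne_one, if_false] at h
      rw [Prod.mk.injEq]
      exact ⟨eP.symm.injective (β.injective (Subtype.val_injective h)), rfl⟩
  have hf_bij : Function.Bijective f := by
    rw [Fintype.bijective_iff_injective_and_card]
    exact ⟨hf_inj, by simp [Fintype.card_prod, Fintype.card_fin, mul_comm]⟩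
  let π : Equiv.Perm (Fin (2 * p)) := (posEquiv p).symm.trans (Equiv.ofBijective f hf_bij)
  have hπ0 : ∀ c, π (posEquiv p (c, 0)) = (eP.symm c : Fin (2 * p)) := fun c => by
    simp [π, f]
  have hπ1 : ∀ c, π (posEquiv p (c, 1)) = (β (eP.symm c) : Fin (2 * p)) := fun c => by
    simp [π, f]
  refine ⟨π, eP, ?_⟩
  set I : Fin p → ι' := fun c => t (eP.symm c : Fin (2 * p)) with hI
  set J : Fin p → ι' := fun c => t (β (eP.symm c) : Fin (2 * p)) with hJ
  -- the words constant along the pairs are parametrised by their letters on the pairs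
  let cIdx : Fin (2 * p) → Fin p := fun q => ((posEquiv p).symm (π.symm q)).1
  have cIdx_P : ∀ c, cIdx (eP.symm c : Fin (2 * p)) = c := fun c => by
    change ((posEquiv p).symm (π.symm (eP.symm c : Fin (2 * p)))).1 = c
    rw [← hπ0 c, Equiv.symm_apply_apply, Equiv.symm_apply_apply]
  have cIdx_Q : ∀ c, cIdx (β (eP.symm c) : Fin (2 * p)) = c := fun c => by
    change ((posEquiv p).symm (π.symm (β (eP.symm c) : Fin (2 * p)))).1 = c
    rw [← hπ1 c, Equiv.symm_apply_apply, Equiv.symm_apply_apply]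
  let ofLam : (Fin p → Fin n) → Word n (2 * p) := fun lam q => lam (cIdx q)
  have hind : ∀ ε : Word n (2 * p), contractionTensor K ty β ε =
      ∑ lam : Fin p → Fin n, if ε = ofLam lam then 1 else 0 := by
    intro ε
    rw [contractionTensor_apply]
    by_cases h : ∀ a : {q : Fin (2 * p) // ty q = true}, ε a = ε (β a)
    · rw [if_pos h, Finset.sum_eq_single (fun c => ε (eP.symm c : Fin (2 * p)))]
      · rw [if_pos]
        funext q
        change ε q = ε (eP.symm (cIdx q) : Fin (2 * p))
        -- `q` is `a_c` or `β a_c` for `c = cIdx q`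
        obtain ⟨cr, hcr⟩ : ∃ cr : Fin p × Fin 2, π (posEquiv p cr) = q :=
          ⟨(posEquiv p).symm (π.symm q), by rw [Equiv.apply_symm_apply, Equiv.apply_symm_apply]⟩
        obtain ⟨c, r⟩ := cr
        rcases fin2_cases r with rfl | rfl
        · rw [hπ0] at hcr
          rw [← hcr, cIdx_P]
        · rw [hπ1] at hcr
          rw [← hcr, cIdx_Q]
          exact (h (eP.symm c)).symm
      · intro lam _ hlam
        rw [if_neg]
        rintro rfl
        exact hlam (funext fun c => by change lam c = lam (cIdx _); rw [cIdx_P])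
      · intro hh
        exact absurd (Finset.mem_univ _) hh
    · rw [if_neg h]
      refine (Finset.sum_eq_zero fun lam _ => ?_).symm
      rw [if_neg]
      rintro rfl
      refine h fun a => ?_
      change lam (cIdx a) = lam (cIdx (β a))
      have ha : (a : Fin (2 * p)) = (eP.symm (eP a) : Fin (2 * p)) := by rw [Equiv.symm_apply_apply]
      conv_lhs => rw [ha, cIdx_P]
      rw [show β a = β (eP.symm (eP a)) by rw [Equiv.symm_apply_apply], cIdx_Q]
  -- expand the contraction tensor and sum out the words
  have h1 : ∑ ε : Word n (2 * p), contractionTensor K ty β ε • F (fun q => y (t q, ε q)) =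
      ∑ lam : Fin p → Fin n, F (fun q => y (t q, ofLam lam q)) := by
    simp_rw [hind, Finset.sum_smul]
    rw [Finset.sum_comm]
    refine Finset.sum_congr rfl fun lam _ => ?_
    simp_rw [ite_smul, one_smul, zero_smul]
    rw [Finset.sum_ite_eq']
    simp
  rw [h1, Finset.smul_sum]
  refine Finset.sum_congr rfl fun lam _ => ?_
  -- the word, reordered into consecutive pairs, is the contracted pair word
  have hcomp : (fun q => y (t q, ofLam lam q)) ∘ ⇑π = glPairWord y I J lam := by
    funext q
    obtain ⟨⟨c, r⟩, rfl⟩ := (posEquiv p).surjective q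
    simp only [Function.comp_apply, glPairWord, Equiv.symm_apply_apply]
    rcases fin2_cases r with rfl | rfl
    · rw [hπ0, if_pos rfl]
      change y (t _, lam (cIdx _)) = _
      rw [cIdx_P]
    · rw [hπ1, if_neg (by decide)]
      change y (t _, lam (cIdx _)) = _
      rw [cIdx_Q]
  have h := map_comp_perm_eq_sign_smul F (fun q => y (t q, ofLam lam q)) π
  rw [hcomp] at h
  rw [h, smul_smul, sign_cast_mul_self, one_smul]

end ContractionEval

/-! ### §3 Prop. 3.6 (c) with multiplicity for `GL`-blocks: the invariants are Lefschetz classes -/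

section Main

variable {B : AbelianVariety ℂ} {J ι : Type*} [Fintype J] [DecidableEq J] [Fintype ι] [DecidableEq ι] {n : ℕ}

/-- **Milne 1999, Prop. 3.6 (c) with multiplicity, `S(ℂ)`-form on the carriers.** Let `B` be a complex
abelian variety, `b` a basis of `H¹(B(ℂ); ℂ)` indexed by slots `s ∈ J` and letters `ℓ ∈ Fin n`, every slot
carrying a colour `col s ∈ ι` and a type `vec s` (`true`: the slot is a copy of `W_{col s} = ℂⁿ`, `false`:
a copy of the dual `W_{col s}^∨`), and `G ≤ GL(H¹)` a subgroup containing, for every `g ∈ ∏_i GL_n(ℂ)`,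
the element acting on the slot `s` by `g_{col s}` (vector slots) resp. `(g_{col s}⁻¹)ᵀ` (covector slots)
— the group `∏_σ GL(W_σ)` acting on `⊕_σ (W_σ ⊗ ℂ^{m_σ} ⊕ W_σ^∨ ⊗ ℂ^{m'_σ})` ("`S_σ ≈ GL_{g/f}`, standard
⊕ contragredient" with multiplicity, Milne p. 650 and p. 656). Suppose the CROSSED CLASSES
`θ_{s,s'} = ∑_ℓ b(s,ℓ) ⌣ b(s',ℓ)` of a vector slot `s` and a covector slot `s'` of the same colour (the
degree-`2` invariants: the pairings `W_σ ⊗ W_σ^∨ → ℂ`) lie in `B¹(B) ⊗ ℂ`. Then every class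
`x ∈ H^{2p}(B(ℂ); ℂ)` fixed by `⋀^{2p}u` for all `u ∈ G` lies in `Dᵖ(B) ⊗ ℂ = divisorClassesSpan B.X B.dim p`
("`(⋀^*(rH))^G = k[(⊗² rH)^G]`, (c) `G = GL(W)` and `V = W ⊕ W^∨`", with Remark 3.7 and p. 656). Proof:
§1 (slices of the antisymmetric coefficient function are `∏ GL`-invariant mixed tensors), the tensor FFT
for `GL` (`ClassicalInvariants.mem_span_contractionTensor_of_forall_wordRepAt_mixedFamily_eq`,
Goodman–Wallach Thm. 5.3.1, coloured), and §2 (a complete contraction evaluates to `±` a product of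
crossed classes). [cite: Milne1999LefschetzClasses, Prop. 3.6 (c) (p. 655), Remark 3.7 and p. 656, Cor. 4.5 (p. 659)]
[cite: GoodmanWallachGTM255, Thm. 5.3.1] -/
theorem mem_divisorClassesSpan_of_forall_exteriorPullback_eq_of_glColouring
    (b : Module.Basis (J × Fin n) ℂ (complexBetti B.X 1)) (col : J → ι) (vec : J → Bool)
    (G : Subgroup (complexBetti B.X 1 ≃ₗ[ℂ] complexBetti B.X 1))
    (hG : ∀ g : ι → GL (Fin n) ℂ, ∃ u ∈ G, ∀ s ℓ,
      u (b (s, ℓ)) = ∑ ℓ', (if vec s then (g (col s) : Matrix (Fin n) (Fin n) ℂ)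
        else (((g (col s))⁻¹ : GL (Fin n) ℂ) : Matrix (Fin n) (Fin n) ℂ)ᵀ) ℓ' ℓ • b (s, ℓ'))
    (hcross : ∀ s s', vec s = true → vec s' = false → col s = col s' →
      (∑ ℓ : Fin n, cupProduct (rfl : 1 + 1 = 2) (b (s, ℓ)) (b (s', ℓ))) ∈
        Submodule.span ℂ {c : complexBetti B.X 2 | IsRationalClass c ∧ IsOfHodgeType B.dim B.X 2 1 1 c})
    (p : ℕ) (x : complexBetti B.X (2 * p))
    (hx : ∀ u ∈ G, exteriorPullback (AbelianVariety.hasExteriorCohomologyH1_complexPoints B)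
      (u : complexBetti B.X 1 →ₗ[ℂ] complexBetti B.X 1) (2 * p) x = x) :
    x ∈ divisorClassesSpan B.X B.dim p := by
  classical
  set F := cupPowOneAlt ℂ (ComplexPoints B.X) (2 * p) with hF
  obtain ⟨a, ha, hax⟩ := exists_isAntisymm_wordEval_eq b x
  -- every slice is a `∏ GL`-invariant mixed tensor
  have hinv : ∀ (t : Fin (2 * p) → J) (g : ι → GL (Fin n) ℂ),
      wordRepAt ℂ (mixedFamily ℂ (col ∘ t) (vec ∘ t) g) (wordSlice a t) = wordSlice a t := by
    intro t g
    obtain ⟨u, huG, hu⟩ := hG g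
    have h := wordRepAt_wordSlice_eq_of_exteriorPullback_eq' b ha (u : complexBetti B.X 1 →ₗ[ℂ] complexBetti B.X 1)
      (fun s => if vec s then (g (col s) : Matrix (Fin n) (Fin n) ℂ)
        else (((g (col s))⁻¹ : GL (Fin n) ℂ) : Matrix (Fin n) (Fin n) ℂ)ᵀ)
      (fun s ℓ => hu s ℓ) (by rw [hax]; exact hx u huG) t
    exact h
  -- slice by slice: the tensor FFT for `GL` and the evaluation of the complete contractions
  rw [← hax, wordEval_eq_sum_wordSlice]
  refine Submodule.sum_mem _ fun t _ => ?_
  have hmem := mem_span_contractionTensor_of_forall_wordRepAt_mixedFamily_eq (col ∘ t) (vec ∘ t)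
    (wordSlice a t) (hinv t)
  set Λ := Fintype.linearCombination ℂ (fun ε : Word n (2 * p) => F (fun q => b (t q, ε q))) with hΛ
  have hΛapply : ∀ c : Word n (2 * p) → ℂ, Λ c = ∑ ε, c ε • F (fun q => b (t q, ε q)) :=
    fun c => Fintype.linearCombination_apply ℂ _ c
  rw [← hΛapply]
  refine (Submodule.span_le (p := (divisorClassesSpan B.X B.dim p).comap Λ)).2 ?_ hmem
  rintro _ ⟨β, hβ, rfl⟩
  rw [SetLike.mem_coe, Submodule.mem_comap, hΛapply]
  obtain ⟨π, eP, hsum⟩ := sum_contractionTensor_smul_eq F (vec ∘ t) β (⇑b) t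
  rw [hsum]
  refine Submodule.smul_mem _ _ ?_
  simp_rw [hF, cupPowOneAlt_apply]
  refine sum_cupPowOne_glPairWord_mem (⇑b) p _ _ fun c => hcross _ _ (eP.symm c).2 (β (eP.symm c)).2 ?_
  exact (hβ (eP.symm c)).symm

end Main

end Literature.AlgebraicGeometry.Milne1999
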